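import Summits.AnomalousDissipation.AnomalousDissipation.Theses.TwoAndHalfD
import Summits.AnomalousDissipation.AnomalousDissipation.Theorems.TwoAndHalfDTwohalfdThesisStubLogGate
import Literature.Analysis.FluidPDE.PassiveScalarClassicalEnergy

/-!
# The gradient blow-up `stub_gradientBlowup` (line `Sketch`, crux stmt-AnomalousDissipation-0206)

Registered stub of the line `Sketch` (duhamel-release) for the crux
`Summit.AnomalousDissipation.AnomalousDissipation.Theses.TwoAndHalfD.TwohalfdThesis`
(stmt-AnomalousDissipation-0206): a NECESSARY CONDITION on every design of the line's open witness
`stub_releasedMixingWitness`, namely the landed log gate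
`releaseEnvelope_false_of_gradient_bound` read in the witness's own format.

CONTENT. Let `ν_j → 0⁺`, let `v_j` be planar drifts, and let `φ j s` be the unforced classical
passive-scalar releases of one smooth pattern `h ≠ 0` at the times `s ≥ 0`
(`∂ₜφ + v_j·∇φ = ν_jΔφ` on `[s, ∞) × 𝕋²`, `φ j s s = h`; `Torus.IsClassicalScalarTransportOn`)
obeying ONE `L²` envelope `‖φ j s (t)‖² ≤ Λ(t - s)² ‖h‖²` for all `s₀ ≤ s ≤ t`, with `Λ ≥ 0`
integrable on `[0, ∞)`. Then the velocity gradients are unbounded after `s₀`: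
`sup_{j, t ≥ s₀, i, x} ‖∂ᵢ v_j(t)(x)‖ = ∞`, i.e. for every `L` some `‖∂ᵢ v_j(t)(x)‖ > L` with
`t ≥ s₀`.

PROOF. Fix `L` and suppose `‖∂ᵢ v_j(t)(x)‖ ≤ L` for all `j`, `t ≥ s₀`, `i`, `x`.
(a) There is `τ₀ > 0` with `Λ τ₀ ≤ 1/2`: otherwise `Λ > 1/2` on `(0, ∞)`, so the constant `1/2`
is dominated by the integrable `Λ` on `(0, ∞)`, a set of infinite Lebesgue measure — absurd.
(b) Restrict the releases at time `s₀` to the window `[s₀, s₀ + τ₀]`; the envelope at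
`s = s₀`, `t = s₀ + τ₀` gives the `j`-uniform loss `‖φ j s₀ (s₀ + τ₀)‖² ≤ Λ(τ₀)²‖h‖² ≤ (1/2)‖h‖²`
(`0 ≤ Λ τ₀ ≤ 1/2`), and the log gate `releaseEnvelope_false_of_gradient_bound` (uniformly
Lipschitz drifts admit no `j`-uniform loss of a fixed fraction of energy as `ν_j → 0`) returns
`False`. Supports stmt-AnomalousDissipation-0206. [folklore: Batchelor 1959; Miles–Doering,
Nonlinearity 31 (2018), §2]
-/

noncomputable section

-- the summit path `AnomalousDissipation/AnomalousDissipation` duplicates a namespace component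
set_option linter.dupNamespace false

namespace Summit.AnomalousDissipation.AnomalousDissipation.Theorems.TwohalfdThesis

open MeasureTheory Set Filter Topology
open scoped ENNReal NNReal InnerProductSpace
open Literature.Analysis.FunctionSpaces Literature.Analysis.FluidPDE

/-- **An integrable envelope dips below `1/2`.** If `Λ` is integrable on `[0, ∞)` then
`Λ τ₀ ≤ 1/2` for some `τ₀ > 0`: otherwise the constant `1/2` is dominated by `Λ` on `(0, ∞)`,
hence integrable on a set of infinite Lebesgue measure. [folklore] -/
private theorem exists_pos_envelope_le_half {Λ : ℝ → ℝ} (hΛi : IntegrableOn Λ (Ici 0)) :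
    ∃ τ₀ : ℝ, 0 < τ₀ ∧ Λ τ₀ ≤ 1 / 2 := by
  by_contra hcon
  push Not at hcon
  have hconst : IntegrableOn (fun _ : ℝ => (1 / 2 : ℝ)) (Ioi 0) volume := by
    refine Integrable.mono' (hΛi.mono_set Ioi_subset_Ici_self) aestronglyMeasurable_const ?_
    refine ae_restrict_of_forall_mem measurableSet_Ioi fun τ hτ => ?_
    rw [Real.norm_eq_abs, abs_of_pos (by norm_num : (0 : ℝ) < 1 / 2)]
    exact (hcon τ hτ).le
  rcases (integrableOn_const_iff).1 hconst with h0 | hfin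
  · exact absurd (enorm_eq_zero.1 h0) (by norm_num)
  · simp [Real.volume_Ioi] at hfin

/-- **Gradient blow-up: the log gate in the released-witness format (necessary condition).**
Let `ν_j → 0⁺`, `v_j` planar drifts, and `φ j s` the classical releases of one smooth pattern
`h` with `‖h‖_{L²} > 0` at times `s ≥ 0` (`∂ₜφ + v_j·∇φ = ν_jΔφ` on `[s, ∞)`, `φ j s s = h`),
obeying one `L²` envelope `‖φ j s (t)‖² ≤ Λ(t - s)²‖h‖²` for `s₀ ≤ s ≤ t` with `Λ ≥ 0` integrable
on `[0, ∞)`. Then for every `L` there are `j`, `t ≥ s₀`, `i`, `x` with `‖∂ᵢ v_j(t)(x)‖ > L`: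
pick `τ₀ > 0` with `Λ τ₀ ≤ 1/2` (integrability), restrict the releases at `s₀` to
`[s₀, s₀ + τ₀]`, read off the uniform loss `‖φ j s₀ (s₀ + τ₀)‖² ≤ (1/2)‖h‖²`, and apply the log
gate `releaseEnvelope_false_of_gradient_bound`. [folklore] -/
theorem stub_gradientBlowup : ∀ (ν : ℕ → ℝ) (v : ℕ → ℝ → (UnitAddTorus (Fin 2)) → (EuclideanSpace ℝ (Fin 2))) (h : (UnitAddTorus (Fin 2)) → ℝ) (φ : ℕ → ℝ → ℝ → (UnitAddTorus (Fin 2)) → ℝ) (Λ : ℝ → ℝ) (s₀ : ℝ), (∀ j, 0 < ν j) → Tendsto ν atTop (𝓝 0) → Torus.IsSmooth h → 0 < Torus.scalarL2Sq h → (∀ j s, 0 ≤ s → Torus.IsClassicalScalarTransportOn (Ici s) (ν j) (v j) (φ j s) ∧ φ j s s = h) → 0 ≤ s₀ → (∀ τ, 0 ≤ Λ τ) → IntegrableOn Λ (Ici 0) → (∀ j s t, s₀ ≤ s → s ≤ t → Torus.scalarL2Sq (φ j s t) ≤ Λ (t - s) ^ 2 * Torus.scalarL2Sq h) → ∀ L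 : ℝ, ∃ (j : ℕ) (t : ℝ) (i : Fin 2) (x : UnitAddTorus (Fin 2)), s₀ ≤ t ∧ L < ‖Torus.partialDeriv i (v j t) x‖ := by
  intro ν v h φ Λ s₀ hν hν0 hh hh2 hrel hs₀ hΛ0 hΛi henv L
  by_contra hcon
  push Not at hcon
  -- (a) a window length `τ₀ > 0` on which the envelope forces a loss of half the energy
  obtain ⟨τ₀, hτ₀, hΛτ₀⟩ := exists_pos_envelope_le_half hΛi
  -- (b) the log gate on the window `[s₀, s₀ + τ₀]` with `δ = 1/2`
  refine releaseEnvelope_false_of_gradient_bound ν v h (fun j => φ j s₀) L s₀ τ₀ (1 / 2) hν hν0 hh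
    hh2 hτ₀ (by norm_num) ?_ ?_ ?_
  · intro j
    exact ⟨(hrel j s₀ hs₀).1.restrict_Icc (by linarith) Icc_subset_Ici_self, (hrel j s₀ hs₀).2⟩
  · intro j t ht i x
    exact hcon j t i x ht.1
  · intro j
    have h1 := henv j s₀ (s₀ + τ₀) le_rfl (by linarith)
    rw [add_sub_cancel_left] at h1
    have h2 : Λ τ₀ ^ 2 ≤ 1 - 1 / 2 := by nlinarith [hΛ0 τ₀]
    exact h1.trans (mul_le_mul_of_nonneg_right h2 (Torus.scalarL2Sq_nonneg h))

end Summit.AnomalousDissipation.AnomalousDissipation.Theorems.TwohalfdThesis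

end
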